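import Literature.ModelTheory.ExponentialFields.KMOPointwiseDefinable
import Literature.ModelTheory.ExponentialFields.DefinableClosureElementary
import Literature.ModelTheory.ExponentialFields.DefinabilityParams
import HarnessLib

/-!
# Proof of KMO Theorem 1 for `ℂ_exp`: real abelian numbers are pointwise definable

Topic `Literature/ModelTheory/ExponentialFields`.  This file discharges the named fact
`kmo_realAbelian_pointwiseDefinable` of `KMOPointwiseDefinable.lean`
(Kirby–Macintyre–Onshuus 2012, Theorem 1, for the complex exponential field): every real
abelian number `a ∈ ℚ(ζ + ζ⁻¹)` (`ζ` a root of unity) is definable without parameters in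
`(ℂ, +, ·, −, 0, 1, exp)`.

We follow the printed proof (KMO §2), phrased through the definable closure `dcl(∅)`
(`DefinableClosure.lean`, `isPointwiseDefinable_iff_mem_definableClosure`):

* `dcl(A)` of an exponential field is a subfield containing `ℚ` (it is closed under the
  function symbols — `definableClosureSubstructure` — and under `x ↦ x⁻¹`, whose graph
  `xy = 1 ∨ (x = 0 ∧ y = 0)` is quantifier-free definable):
  `exists_intermediateField_coe_eq_definableClosure`.
* KMO §2.2: `ℤ = {y : ∀ x [E(x) = 1 → E(yx) = 1]}` (`kmo_isInt_iff`, `kmo_definable_isInt`).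
* KMO §2.3: the two generators `{τ, −τ} = {±2πi}` of the kernel are defined by
  `x ∈ Ker ∧ (∀ y ∈ Ker)(∃ n ∈ ℤ)[nx = y]` (`kmo_isKernelGenerator_iff`,
  `kmo_definable_isKernelGenerator`).
* KMO §2.7: for `s ∈ dcl(∅)` the number `E(sτ) + E(−sτ) = 2 cos(2πs)` does not depend on the
  choice of the generator `τ ∈ {±2πi}`, hence lies in `dcl(∅)`
  (`kmo_expSymm_mem_definableClosure`); with `s = k/n` this is `ζ + ζ⁻¹` for
  `ζ = e^{2πik/n}` (`kmo_rootOfUnity_add_inv_mem_definableClosure`), and `ℚ(ζ + ζ⁻¹) ⊆ dcl(∅)`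
  because `dcl(∅)` is a subfield.  (KMO route this through parameter-free definitions of
  `cos`, `sin` and `π`, §2.4–2.6; for the statement of Theorem 1 only the symmetric
  expression of §2.7 is needed, which is what is formalized.)

Main result: `kmo_realAbelian_pointwiseDefinable_holds`.

## References

* [KirbyMacintyreOnshuus2012] J. Kirby, A. Macintyre, A. Onshuus, *The algebraic numbers
  definable in various exponential fields*, J. Inst. Math. Jussieu 11 (2012) 825–834,
  doi:10.1017/s1474748012000047, arXiv:1101.4224 — §1 Theorem 1, §2.2, §2.3, §2.7.
* [Marker2002] D. Marker, *Model Theory: An Introduction*, Exercise 1.4.10 (definable closure).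
-/

noncomputable section

open Set FirstOrder FirstOrder.Language

namespace Literature.ModelTheory.ExponentialFields

/-! ### A unary predicate applied to a definable function -/

section Pred

variable {L : Language} {M : Type*} [L.Structure M] {A : Set M} {α : Type*}

/-- A definable unary predicate applied to a definable function of tuples gives a definable
set of tuples: `{v | P (g v)}` (the unary case of `definable_setOf_rel_params`). [folklore] -/
theorem definable_setOf_pred_params {P : M → Prop}
    (hP : A.Definable L {v : Fin 1 → M | P (v 0)})
    {g : (α → M) → M} (hg : A.DefinableFun L g) :
    A.Definable L {v : α → M | P (g v)} := by
  have hF : A.DefinableMap L (fun v => (![g v] : Fin 1 → M)) :=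
    Fin.forall_fin_one.2 (by simpa using hg)
  simpa using hP.preimage_map hF

end Pred

/-! ### Definable functions in the language of exponential rings -/

section ExpRingFun

variable {M : Type*} [Ring M] [ExponentialRing M] {A : Set M} {α : Type*}

/-- Sums of definable functions are definable (`+` is a function symbol of `L_exp`). [folklore] -/
theorem definableFun_expRing_add {f g : (α → M) → M}
    (hf : A.DefinableFun Language.expRing f) (hg : A.DefinableFun Language.expRing g) :
    A.DefinableFun Language.expRing (fun v => f v + g v) := by
  have hF : A.DefinableMap Language.expRing (fun v => (![f v, g v] : Fin 2 → M)) :=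
    Fin.forall_fin_two.2 ⟨by simpa using hf, by simpa using hg⟩
  simpa using ((Set.DefinableFun.fun_symbol (L := Language.expRing) (M := M)
    (expRingFunc.add : Language.expRing.Functions 2)).of_empty (A := A)).comp hF

/-- Products of definable functions are definable (`·` is a symbol of `L_exp`). [folklore] -/
theorem definableFun_expRing_mul {f g : (α → M) → M}
    (hf : A.DefinableFun Language.expRing f) (hg : A.DefinableFun Language.expRing g) :
    A.DefinableFun Language.expRing (fun v => f v * g v) := by
  have hF : A.DefinableMap Language.expRing (fun v => (![f v, g v] : Fin 2 → M)) :=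
    Fin.forall_fin_two.2 ⟨by simpa using hf, by simpa using hg⟩
  simpa using ((Set.DefinableFun.fun_symbol (L := Language.expRing) (M := M)
    (expRingFunc.mul : Language.expRing.Functions 2)).of_empty (A := A)).comp hF

/-- Negatives of definable functions are definable (`−` is a symbol of `L_exp`). [folklore] -/
theorem definableFun_expRing_neg {f : (α → M) → M}
    (hf : A.DefinableFun Language.expRing f) :
    A.DefinableFun Language.expRing (fun v => -f v) := by
  have hF : A.DefinableMap Language.expRing (fun v => (![f v] : Fin 1 → M)) :=
    Fin.forall_fin_one.2 (by simpa using hf)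
  simpa using ((Set.DefinableFun.fun_symbol (L := Language.expRing) (M := M)
    (expRingFunc.neg : Language.expRing.Functions 1)).of_empty (A := A)).comp hF

/-- Exponentials of definable functions are definable (`exp` is a symbol of `L_exp`). [folklore] -/
theorem definableFun_expRing_exp {f : (α → M) → M}
    (hf : A.DefinableFun Language.expRing f) :
    A.DefinableFun Language.expRing (fun v => ExponentialRing.exp (f v)) := by
  have hF : A.DefinableMap Language.expRing (fun v => (![f v] : Fin 1 → M)) :=
    Fin.forall_fin_one.2 (by simpa using hf)
  simpa using ((Set.DefinableFun.fun_symbol (L := Language.expRing) (M := M)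
    (expRingFunc.exp : Language.expRing.Functions 1)).of_empty (A := A)).comp hF

/-- The constant function `0` is definable (a closed term of `L_exp`). [folklore] -/
theorem definableFun_expRing_zero :
    A.DefinableFun Language.expRing (fun _ : α → M => (0 : M)) := by
  simpa using (Term.definableFun_realize (L := Language.expRing) (M := M)
    (0 : Language.expRing.Term α)).of_empty (A := A)

/-- The constant function `1` is definable (a closed term of `L_exp`). [folklore] -/
theorem definableFun_expRing_one :
    A.DefinableFun Language.expRing (fun _ : α → M => (1 : M)) := by
  simpa using (Term.definableFun_realize (L := Language.expRing) (M := M)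
    (1 : Language.expRing.Term α)).of_empty (A := A)

end ExpRingFun

/-! ### `dcl(A)` of an exponential field is a subfield -/

section ExpRingDcl

variable {M : Type*} [Ring M] [ExponentialRing M] {A : Set M}

/-- `dcl(A)` is closed under `+`. [cite: Marker2002, Exercise 1.4.10] -/
theorem expRing_add_mem_definableClosure {a b : M}
    (ha : a ∈ definableClosure Language.expRing A)
    (hb : b ∈ definableClosure Language.expRing A) :
    a + b ∈ definableClosure Language.expRing A :=
  (definableClosureSubstructure Language.expRing A).fun_mem
    (expRingFunc.add : Language.expRing.Functions 2) ![a, b] (Fin.forall_fin_two.2 ⟨ha, hb⟩)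

/-- `dcl(A)` is closed under `·`. [cite: Marker2002, Exercise 1.4.10] -/
theorem expRing_mul_mem_definableClosure {a b : M}
    (ha : a ∈ definableClosure Language.expRing A)
    (hb : b ∈ definableClosure Language.expRing A) :
    a * b ∈ definableClosure Language.expRing A :=
  (definableClosureSubstructure Language.expRing A).fun_mem
    (expRingFunc.mul : Language.expRing.Functions 2) ![a, b] (Fin.forall_fin_two.2 ⟨ha, hb⟩)

/-- `dcl(A)` is closed under `−`. [cite: Marker2002, Exercise 1.4.10] -/
theorem expRing_neg_mem_definableClosure {a : M}
    (ha : a ∈ definableClosure Language.expRing A) :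
    -a ∈ definableClosure Language.expRing A :=
  (definableClosureSubstructure Language.expRing A).fun_mem
    (expRingFunc.neg : Language.expRing.Functions 1) ![a] (Fin.forall_fin_one.2 ha)

/-- `dcl(A)` is closed under `exp`. [cite: Marker2002, Exercise 1.4.10] -/
theorem expRing_exp_mem_definableClosure {a : M}
    (ha : a ∈ definableClosure Language.expRing A) :
    ExponentialRing.exp a ∈ definableClosure Language.expRing A :=
  (definableClosureSubstructure Language.expRing A).fun_mem
    (expRingFunc.exp : Language.expRing.Functions 1) ![a] (Fin.forall_fin_one.2 ha)

/-- `0 ∈ dcl(A)`. [cite: Marker2002, Exercise 1.4.10] -/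
theorem expRing_zero_mem_definableClosure :
    (0 : M) ∈ definableClosure Language.expRing A :=
  (definableClosureSubstructure Language.expRing A).fun_mem
    (expRingFunc.zero : Language.expRing.Functions 0) ![] (fun i => i.elim0)

/-- `1 ∈ dcl(A)`. [cite: Marker2002, Exercise 1.4.10] -/
theorem expRing_one_mem_definableClosure :
    (1 : M) ∈ definableClosure Language.expRing A :=
  (definableClosureSubstructure Language.expRing A).fun_mem
    (expRingFunc.one : Language.expRing.Functions 0) ![] (fun i => i.elim0)

end ExpRingDcl

section ExpFieldDcl

variable {M : Type*} [Field M] [ExponentialRing M] {A : Set M}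

/-- In an exponential field the graph of `x ↦ x⁻¹` (with `0⁻¹ = 0`) is definable without
parameters by the quantifier-free formula `x y = 1 ∨ (x = 0 ∧ y = 0)`. [folklore] -/
theorem expField_definable_invGraph :
    A.Definable Language.expRing {v : Fin 2 → M | v 1 = (v 0)⁻¹} := by
  have h : A.Definable Language.expRing
      {v : Fin 2 → M | v 0 * v 1 = 1 ∨ (v 0 = 0 ∧ v 1 = 0)} :=
    definable_setOf_or_params
      (definable_setOf_eq_params
        (definableFun_expRing_mul (definableFun_proj_params 0) (definableFun_proj_params 1))
        definableFun_expRing_one)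
      (definable_setOf_and_params
        (definable_setOf_eq_params (definableFun_proj_params 0) definableFun_expRing_zero)
        (definable_setOf_eq_params (definableFun_proj_params 1) definableFun_expRing_zero))
  refine (congrArg _ ?_).mpr h
  ext v
  simp only [mem_setOf_eq]
  constructor
  · intro hv
    by_cases h0 : v 0 = 0
    · exact Or.inr ⟨h0, by rw [hv, h0, inv_zero]⟩
    · exact Or.inl (by rw [hv, mul_inv_cancel₀ h0])
  · rintro (h1 | ⟨h0, h1⟩)
    · exact eq_inv_of_mul_eq_one_right h1
    · rw [h1, h0, inv_zero]

/-- `dcl(A)` of an exponential field is closed under `x ↦ x⁻¹`. [cite: Marker2002, Exercise 1.4.10] -/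
theorem expField_inv_mem_definableClosure {a : M}
    (ha : a ∈ definableClosure Language.expRing A) :
    a⁻¹ ∈ definableClosure Language.expRing A :=
  apply_mem_definableClosure (f := fun x : M => x⁻¹) expField_definable_invGraph ha

variable [CharZero M]

variable (A) in
/-- **`dcl(A)` of an exponential field (of characteristic zero) is a subfield containing `ℚ`**:
there is an intermediate field `ℚ ⊆ F ⊆ M` whose carrier is `dcl(A)` (Marker 2002,
Exercise 1.4.10: `dcl(A)` is closed under definable functions). [cite: Marker2002, Exercise 1.4.10] -/
theorem exists_intermediateField_coe_eq_definableClosure :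
    ∃ F : IntermediateField ℚ M, (F : Set M) = definableClosure Language.expRing A := by
  refine ⟨Subfield.toIntermediateField
    { carrier := definableClosure Language.expRing A
      mul_mem' := expRing_mul_mem_definableClosure
      one_mem' := expRing_one_mem_definableClosure
      add_mem' := expRing_add_mem_definableClosure
      zero_mem' := expRing_zero_mem_definableClosure
      neg_mem' := expRing_neg_mem_definableClosure
      inv_mem' := fun x hx => expField_inv_mem_definableClosure hx } (fun q => ?_), rfl⟩
  rw [eq_ratCast]
  exact SubfieldClass.ratCast_mem _ q

end ExpFieldDcl

/-! ### The complex exponential field: KMO §2.2, §2.3, §2.7 -/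

section Complex

open _root_.Complex
open scoped _root_.Real

/-- `exp` of a definable function is definable, `ℂ_exp` version with `Complex.exp`. [folklore] -/
theorem definableFun_cexp {A : Set ℂ} {α : Type*} {f : (α → ℂ) → ℂ}
    (hf : A.DefinableFun Language.expRing f) :
    A.DefinableFun Language.expRing (fun v => cexp (f v)) :=
  definableFun_expRing_exp hf

/-- **KMO §2.2, defining `ℤ`**: in `ℂ_exp`, `m ∈ ℤ` iff `∀ x [E(x) = 1 → E(mx) = 1]` (the
multiplicative stabiliser of the kernel `2πiℤ`). [cite: KirbyMacintyreOnshuus2012, §2.2] -/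
theorem kmo_isInt_iff (m : ℂ) :
    (∃ k : ℤ, (k : ℂ) = m) ↔ ∀ x : ℂ, cexp x = 1 → cexp (m * x) = 1 := by
  constructor
  · rintro ⟨k, rfl⟩ x hx
    rw [Complex.exp_int_mul, hx, one_zpow]
  · intro h
    obtain ⟨n, hn⟩ := Complex.exp_eq_one_iff.1 (h _ Complex.exp_two_pi_mul_I)
    exact ⟨n, (mul_right_cancel₀ Complex.two_pi_I_ne_zero hn).symm⟩

/-- `ℤ ⊆ ℂ` is `∅`-definable in `ℂ_exp` (KMO §2.2, a `∀`-definition). [cite: KirbyMacintyreOnshuus2012, §2.2] -/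
theorem kmo_definable_isInt :
    (∅ : Set ℂ).Definable Language.expRing {v : Fin 1 → ℂ | ∃ k : ℤ, (k : ℂ) = v 0} := by
  have h : (∅ : Set ℂ).Definable Language.expRing
      {v : Fin 1 → ℂ | ∀ x : ℂ, cexp x = 1 → cexp (v 0 * x) = 1} := by
    refine definable_setOf_forall_params ?_
    refine definable_setOf_imp_params ?_ ?_
    · exact definable_setOf_eq_params (definableFun_cexp (definableFun_proj_params _))
        definableFun_expRing_one
    · exact definable_setOf_eq_params
        (definableFun_cexp (definableFun_expRing_mul (definableFun_proj_params _)
          (definableFun_proj_params _))) definableFun_expRing_one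
  refine (congrArg _ ?_).mpr h
  ext v
  exact kmo_isInt_iff (v 0)

/-- **KMO §2.3, defining `{τ, −τ}`**: in `ℂ_exp`, `t` is one of the two generators `±2πi` of
the kernel iff `t ∈ Ker ∧ (∀ y ∈ Ker)(∃ n ∈ ℤ)[nt = y]`. [cite: KirbyMacintyreOnshuus2012, §2.3] -/
theorem kmo_isKernelGenerator_iff (t : ℂ) :
    (t = 2 * π * I ∨ t = -(2 * π * I)) ↔
      (cexp t = 1 ∧ ∀ y : ℂ, cexp y = 1 → ∃ m : ℂ, (∃ k : ℤ, (k : ℂ) = m) ∧ m * t = y) := by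
  constructor
  · rintro (rfl | rfl)
    · refine ⟨Complex.exp_two_pi_mul_I, fun y hy => ?_⟩
      obtain ⟨n, rfl⟩ := Complex.exp_eq_one_iff.1 hy
      exact ⟨n, ⟨n, rfl⟩, rfl⟩
    · refine ⟨by rw [Complex.exp_neg, Complex.exp_two_pi_mul_I, inv_one], fun y hy => ?_⟩
      obtain ⟨n, rfl⟩ := Complex.exp_eq_one_iff.1 hy
      exact ⟨-(n : ℂ), ⟨-n, Int.cast_neg n⟩, by ring⟩
  · rintro ⟨ht, hall⟩
    obtain ⟨j, hj⟩ := Complex.exp_eq_one_iff.1 ht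
    obtain ⟨m, ⟨k, rfl⟩, hk⟩ := hall (2 * π * I) Complex.exp_two_pi_mul_I
    rw [hj] at hk
    have h1 : ((j : ℂ) * k) * (2 * π * I) = 1 * (2 * π * I) := by
      linear_combination hk
    have hjk : j * k = 1 := by exact_mod_cast mul_right_cancel₀ Complex.two_pi_I_ne_zero h1
    rcases Int.eq_one_or_neg_one_of_mul_eq_one hjk with rfl | rfl
    · left; rw [hj]; simp
    · right; rw [hj]; simp

/-- The two-element set `{2πi, −2πi}` is `∅`-definable in `ℂ_exp` (KMO §2.3). [cite: KirbyMacintyreOnshuus2012, §2.3] -/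
theorem kmo_definable_isKernelGenerator :
    (∅ : Set ℂ).Definable Language.expRing
      {v : Fin 1 → ℂ | v 0 = 2 * π * I ∨ v 0 = -(2 * π * I)} := by
  have h : (∅ : Set ℂ).Definable Language.expRing {v : Fin 1 → ℂ |
      cexp (v 0) = 1 ∧ ∀ y : ℂ, cexp y = 1 →
        ∃ m : ℂ, (∃ k : ℤ, (k : ℂ) = m) ∧ m * v 0 = y} := by
    refine definable_setOf_and_params ?_ ?_
    · exact definable_setOf_eq_params (definableFun_cexp (definableFun_proj_params _))
        definableFun_expRing_one
    · refine definable_setOf_forall_params ?_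
      refine definable_setOf_imp_params ?_ ?_
      · exact definable_setOf_eq_params (definableFun_cexp (definableFun_proj_params _))
          definableFun_expRing_one
      · refine definable_setOf_exists_params ?_
        refine definable_setOf_and_params ?_ ?_
        · exact definable_setOf_pred_params (P := fun x : ℂ => ∃ k : ℤ, (k : ℂ) = x)
            kmo_definable_isInt (definableFun_proj_params _)
        · exact definable_setOf_eq_params
            (definableFun_expRing_mul (definableFun_proj_params _) (definableFun_proj_params _))
            (definableFun_proj_params _)
  refine (congrArg _ ?_).mpr h
  ext v
  exact kmo_isKernelGenerator_iff (v 0)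

/-- **KMO §2.7**: for `s ∈ dcl(∅)` the number `E(sτ) + E(−sτ)` (`= 2 cos(2πs)`), which does not
depend on the choice of the generator `τ ∈ {±2πi}` of the kernel, lies in `dcl(∅)`: it is
defined by `∃ t [t ∈ {τ, −τ} ∧ y = E(st) + E(−st)]`. [cite: KirbyMacintyreOnshuus2012, §2.7] -/
theorem kmo_expSymm_mem_definableClosure {s : ℂ}
    (hs : s ∈ definableClosure Language.expRing (∅ : Set ℂ)) :
    cexp (s * (2 * π * I)) + cexp (-(s * (2 * π * I))) ∈
      definableClosure Language.expRing (∅ : Set ℂ) := by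
  -- it suffices to define the point with parameters from `dcl(∅)` (which are eliminable)
  suffices h : (definableClosure Language.expRing (∅ : Set ℂ)).Definable₁ Language.expRing
      ({cexp (s * (2 * π * I)) + cexp (-(s * (2 * π * I)))} : Set ℂ) from
    mem_definableClosure_iff.2 (definable_definableClosure_iff.1 h)
  have hsD : (definableClosure Language.expRing (∅ : Set ℂ)).DefinableFun Language.expRing
      (fun _ : Fin 1 ⊕ Unit → ℂ => s) :=
    definableFun_const_params _ hs
  have hdef : (definableClosure Language.expRing (∅ : Set ℂ)).Definable Language.expRing
      {v : Fin 1 → ℂ |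
      ∃ t : ℂ, (t = 2 * π * I ∨ t = -(2 * π * I)) ∧
        v 0 = cexp (s * t) + cexp (-(s * t))} := by
    refine definable_setOf_exists_params ?_
    refine definable_setOf_and_params ?_ ?_
    · exact definable_setOf_pred_params (P := fun x : ℂ => x = 2 * π * I ∨ x = -(2 * π * I))
        (kmo_definable_isKernelGenerator.mono (empty_subset _)) (definableFun_proj_params _)
    · exact definable_setOf_eq_params (definableFun_proj_params _)
        (definableFun_expRing_add
          (definableFun_cexp (definableFun_expRing_mul hsD (definableFun_proj_params _)))
          (definableFun_cexp (definableFun_expRing_neg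
            (definableFun_expRing_mul hsD (definableFun_proj_params _)))))
  unfold Set.Definable₁
  refine (congrArg _ ?_).mpr hdef
  ext v
  simp only [mem_setOf_eq, mem_singleton_iff]
  constructor
  · exact fun hv => ⟨_, Or.inl rfl, hv⟩
  · rintro ⟨t, ht | ht, hv⟩
    · rw [hv, ht]
    · rw [hv, ht, mul_neg, neg_neg, add_comm]

/-- For a root of unity `ζ ∈ ℂ`, `ζ + ζ⁻¹ = 2 cos(2πk/n) ∈ dcl(∅)` in `ℂ_exp` (KMO §2.7 with
§2.3). [cite: KirbyMacintyreOnshuus2012, §2.7] -/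
theorem kmo_rootOfUnity_add_inv_mem_definableClosure {ζ : ℂ} {n : ℕ} (hn : 0 < n)
    (hζ : ζ ^ n = 1) :
    ζ + ζ⁻¹ ∈ definableClosure Language.expRing (∅ : Set ℂ) := by
  obtain ⟨F, hF⟩ := exists_intermediateField_coe_eq_definableClosure (M := ℂ) (∅ : Set ℂ)
  have hmemF : ∀ x : ℂ, x ∈ F ↔ x ∈ definableClosure Language.expRing (∅ : Set ℂ) :=
    fun x => by rw [← SetLike.mem_coe, hF]
  haveI : NeZero n := ⟨hn.ne'⟩
  obtain ⟨k, -, hk⟩ := (Complex.isPrimitiveRoot_exp n hn.ne').eq_pow_of_pow_eq_one hζ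
  -- `s = k/n ∈ dcl(∅)` since `dcl(∅)` is a subfield
  have hs : ((k : ℂ) / n) ∈ F := div_mem (natCast_mem F k) (natCast_mem F n)
  have hc := kmo_expSymm_mem_definableClosure ((hmemF _).1 hs)
  have hζeq : ζ = cexp ((k : ℂ) / n * (2 * π * I)) := by
    rw [← hk, ← Complex.exp_nat_mul]
    congr 1
    ring
  rwa [hζeq, ← Complex.exp_neg]

/-- Every real abelian number lies in `dcl(∅)` of `ℂ_exp` (KMO Theorem 1 for `ℂ`, `dcl` form).
[cite: KirbyMacintyreOnshuus2012, Theorem 1] -/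
theorem kmo_realAbelian_mem_definableClosure {a : ℂ} (ha : IsRealAbelian a) :
    a ∈ definableClosure Language.expRing (∅ : Set ℂ) := by
  obtain ⟨ζ, ⟨n, hn, hζ⟩, hmem⟩ := ha
  obtain ⟨F, hF⟩ := exists_intermediateField_coe_eq_definableClosure (M := ℂ) (∅ : Set ℂ)
  have hmemF : ∀ x : ℂ, x ∈ F ↔ x ∈ definableClosure Language.expRing (∅ : Set ℂ) :=
    fun x => by rw [← SetLike.mem_coe, hF]
  have hgen : ζ + ζ⁻¹ ∈ F :=
    (hmemF _).2 (kmo_rootOfUnity_add_inv_mem_definableClosure hn hζ)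
  exact (hmemF a).1 ((IntermediateField.adjoin_simple_le_iff.2 hgen) hmem)

/-- **Kirby–Macintyre–Onshuus 2012, Theorem 1, for the complex exponential field**: every real
abelian algebraic number is pointwise definable (without parameters) in `(ℂ, +, ·, −, 0, 1, exp)`.
This discharges the named fact `kmo_realAbelian_pointwiseDefinable`.
[cite: KirbyMacintyreOnshuus2012, Theorem 1] -/
theorem kmo_realAbelian_pointwiseDefinable_holds : kmo_realAbelian_pointwiseDefinable :=
  fun _ ha => (isPointwiseDefinable_iff_mem_definableClosure _).2
    (kmo_realAbelian_mem_definableClosure ha)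

end Complex

end Literature.ModelTheory.ExponentialFields

end
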